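import Literature.Geometry.Riemannian.ExpMapJacobiField
import Literature.Geometry.Riemannian.ExpMapLiftAlgebra
import Literature.Geometry.Riemannian.ConjugatePointsExp
import HarnessLib

/-!
# Nontrivial Jacobi fields of the exponential variation have a nonzero corner
(Lee 2018, Prop. 10.2 / proof of Thm. 10.26: a Jacobi field with `J(b) = 0` and `D_t J(b) = 0`
vanishes identically)

Layer 6d of the programme for `Literature.Geometry.Riemannian.lee_expMap_injectivityDomain`
(Lee 2018, Thm. 10.34, part "`exp_p|_{ID(p)}` has bijective differential", via Thm. 10.26). In the
proof of Thm. 10.26 the broken field `V = J` on `[0, b]`, `V = 0` on `[b, c]` built from a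
nontrivial Jacobi field `J` with `J(0) = J(b) = 0` has the corner `ΔD_tV(b) = -D_t J(b) ≠ 0`,
because "a Jacobi field is determined by `J(b)` and `D_t J(b)`" (Lee 2018, Prop. 10.2, existence
and uniqueness of Jacobi fields). For the Jacobi fields that occur — the variation fields
`J(t) = ∂_s|_{s=0} exp_x(t(v + s w)) = d(exp_x)_{tv}(t w)` of the geodesic variation
(`ExpMapJacobiField.lean`) — this file proves the needed instance of uniqueness WITHOUT the linear
ODE theory, through the geodesic flow:

* `eq_zero_of_velocity_eq_zero_of_covariantDerivAlong_eq_zero` — **if `J(t₁) = 0` and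
  `D_t J(t₁) = 0` for some `t₁ ≥ 0`, then `w = 0`** (so `J ≡ 0`).

Proof. Let `Γ(t, s) = exp_x(t(v + s w))` and consider the curve
`β(s) = (Γ(t₁, s), -∂_tΓ(t₁, s))` in `TM`. Its base velocity at `s = 0` is `J(t₁) = 0` and the
covariant derivative of its fibre part is `-D_s ∂_tΓ(t₁, 0) = -D_t ∂_sΓ(t₁, 0) = -D_t J(t₁) = 0`
(symmetry lemma), so `β'(0) = 0` in `T(TM)`
(`hasMFDerivAt_lift_zero_of_covariantDerivAlong_eq_zero`: in the trivialisation of `TM` at the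
base point, the fibre coordinate of `D_s Z` is the `s`-derivative of the fibre coordinate of `Z`
when the base velocity vanishes, `continuousLinearMapAt_covariantDerivAlong_of_velocity_eq_zero`).
The time-`t₁` geodesic flow `Φ` is differentiable (`exists_nhds_contMDiffOn_geodesicFlow_of_subset`)
and maps `β(s)` to `(x, -(v + s w))`, the data at time `t₁` of the reversed geodesic
`t ↦ Γ(t₁ - t, s)` (uniqueness of geodesics, `tangentLift_eqOn_maximalGeodesic_of_isGeodesicOn`).
By the chain rule `s ↦ (x, -v - s w) ∈ T_xM ⊂ TM` has zero derivative at `s = 0`, whence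
(`covariantDerivAlong_eq_zero_of_mfderiv_lift_eq_zero`, `covariantDerivAlong_const_line`)
`-w = D_s(-v - s w)|_{s=0} = 0`.

No definitions, no named facts (D-0026); no boundarylessness of the model is assumed.

## References

* J. M. Lee, *Introduction to Riemannian Manifolds*, 2nd ed. (2018), Prop. 10.2, Prop. 10.4
  (Jacobi fields as variation fields), Thm. 10.26 (proof), Thm. 9.12 (geodesic flow).
  [LeeRiemannianManifolds2018]
* B. O'Neill, *Semi-Riemannian geometry* (1983), Ch. 8, Lemma 3 and Prop. 8.6; Ch. 10, Thm. 17
  (proof). [ONeill1983]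
-/

noncomputable section

open Bundle Set Filter Function
open scoped Manifold ContDiff Topology

namespace Literature.Geometry.Riemannian

open Literature.Geometry.Lorentzian

variable {E : Type*} [NormedAddCommGroup E] [NormedSpace ℝ E] {H : Type*} [TopologicalSpace H]
  {I : ModelWithCorners ℝ E H} {M : Type*} [TopologicalSpace M] [ChartedSpace H M]
  [IsManifold I ∞ M] [FiniteDimensional ℝ E]
  (cov : CovariantDerivative I E (TangentSpace I : M → Type _))

/-! ### The splitting of `T(TM)` along a curve with vanishing base velocity -/

/-- **Frame reading of `D_s Z` when the base velocity vanishes**: for a field `Z` along a curve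
`c` whose lift `s ↦ (c s, Z s)` is differentiable at `s₀`, if `c'(s₀) = 0` then the
trivialisation of `TM` at `c s₀` reads `D_s Z(s₀)` as the ordinary derivative at `s₀` of the fibre
coordinate `s ↦ (e (c s, Z s)).2` — in the frame formula `DZ/ds = ∑ (cⁱ)' sᵢ + ∑ cⁱ ∇_{c'} sᵢ`
(O'Neill 1983, Ch. 3, Prop. 3.18, p. 66) the second sum vanishes and `∑ (cⁱ)' bᵢ` is the derivative
of the coordinate vector `∑ cⁱ bᵢ`. [cite: ONeill1983, Ch. 3, Prop. 3.18] -/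
theorem continuousLinearMapAt_covariantDerivAlong_of_velocity_eq_zero {c : ℝ → M}
    {Z : Π s : ℝ, TangentSpace I (c s)} {s₀ : ℝ}
    (hZ : MDifferentiableAt 𝓘(ℝ, ℝ) I.tangent
      (fun s ↦ (TotalSpace.mk' E (c s) (Z s) : TangentBundle I M)) s₀)
    (hc : velocity I c s₀ = 0) :
    (trivializationAt E (TangentSpace I : M → Type _) (c s₀)).continuousLinearMapAt ℝ (c s₀)
        (covariantDerivAlong cov c Z s₀) =
      deriv (fun s ↦ ((trivializationAt E (TangentSpace I : M → Type _) (c s₀))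
        (TotalSpace.mk' E (c s) (Z s) : TangentBundle I M)).2) s₀ := by
  have he : c s₀ ∈ (trivializationAt E (TangentSpace I : M → Type _) (c s₀)).baseSet :=
    FiberBundle.mem_baseSet_trivializationAt' (c s₀)
  have hcs : c s₀ ∈ (chartAt H (c s₀)).source := mem_chart_source H (c s₀)
  -- the frame formula with vanishing velocity
  have hD : covariantDerivAlong cov c Z s₀ =
      ∑ i, deriv (fun s ↦ (trivializationAt E (TangentSpace I : M → Type _) (c s₀)).localFrame_coeff
          I (Module.finBasis ℝ E) i (c s) (Z s)) s₀ •
        (trivializationAt E (TangentSpace I : M → Type _) (c s₀)).localFrame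
          (Module.finBasis ℝ E) i (c s₀) := by
    rw [covariantDerivAlong_def]
    simp only [covariantDerivAlongFrame, hc, map_zero, smul_zero, Finset.sum_const_zero, add_zero]
  -- the fibre coordinate is the frame combination of the coefficient functions
  have hcont : ContinuousAt c s₀ := (mdifferentiableAt_of_mdifferentiableAt_lift hZ).continuousAt
  have hev : ∀ᶠ s in 𝓝 s₀, c s ∈ (trivializationAt E (TangentSpace I : M → Type _) (c s₀)).baseSet :=
    hcont.preimage_mem_nhds
      ((trivializationAt E (TangentSpace I : M → Type _) (c s₀)).open_baseSet.mem_nhds he)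
  have hF : (fun s ↦ ((trivializationAt E (TangentSpace I : M → Type _) (c s₀))
      (TotalSpace.mk' E (c s) (Z s) : TangentBundle I M)).2) =ᶠ[𝓝 s₀]
      fun s ↦ ∑ i, (trivializationAt E (TangentSpace I : M → Type _) (c s₀)).localFrame_coeff
          I (Module.finBasis ℝ E) i (c s) (Z s) • Module.finBasis ℝ E i := by
    filter_upwards [hev] with s hs
    have h : ∀ i, (trivializationAt E (TangentSpace I : M → Type _) (c s₀)).localFrame_coeff
        I (Module.finBasis ℝ E) i (c s) (Z s) =
        (Module.finBasis ℝ E).repr (((trivializationAt E (TangentSpace I : M → Type _) (c s₀))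
          (TotalSpace.mk' E (c s) (Z s) : TangentBundle I M)).2) i := fun i ↦
      (trivializationAt E (TangentSpace I : M → Type _) (c s₀)).localFrame_coeff_eq_coeff
        (I := I) (b := Module.finBasis ℝ E)
        (s := fun y ↦ (show TangentSpace I y from (show E from Z s))) hs (i := i)
    simp only [h]
    exact ((Module.finBasis ℝ E).sum_repr _).symm
  have hderiv : HasDerivAt (fun s ↦ ∑ i, (trivializationAt E (TangentSpace I : M → Type _)
      (c s₀)).localFrame_coeff I (Module.finBasis ℝ E) i (c s) (Z s) • Module.finBasis ℝ E i)
      (∑ i, deriv (fun s ↦ (trivializationAt E (TangentSpace I : M → Type _) (c s₀)).localFrame_coeff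
          I (Module.finBasis ℝ E) i (c s) (Z s)) s₀ • Module.finBasis ℝ E i) s₀ := by
    refine HasDerivAt.fun_sum fun i _ ↦ ?_
    exact ((differentiableAt_localFrame_coeff_lift _ (Module.finBasis ℝ E) hZ he
      i).hasDerivAt).smul_const _
  rw [hF.deriv_eq, hderiv.deriv, hD, map_sum]
  refine Finset.sum_congr rfl fun i _ ↦ ?_
  rw [map_smul, continuousLinearMapAt_localFrame (Module.finBasis ℝ E) hcs i]

/-- **Vanishing base velocity and vanishing `D_s Z` give a zero tangent vector in `T(TM)`**:
if the lift `β(s) = (c s, Z s)` is differentiable at `s₀`, `c'(s₀) = 0` and `D_s Z(s₀) = 0`,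
then `β'(s₀) = 0` — in the chart `e` of `TM` at `c s₀`, `e ∘ β = (c, fibre coordinate)` has zero
derivative (`continuousLinearMapAt_covariantDerivAlong_of_velocity_eq_zero`), and `e` is a local
diffeomorphism. This is the horizontal/vertical description of `T(TM)` through a connection
(O'Neill 1983, Ch. 3, Prop. 3.18; Lee 2018, Problem 4-7) in the only case needed here.
[cite: ONeill1983, Ch. 3, Prop. 3.18] -/
theorem hasMFDerivAt_lift_zero_of_covariantDerivAlong_eq_zero {c : ℝ → M}
    {Z : Π s : ℝ, TangentSpace I (c s)} {s₀ : ℝ}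
    (hZ : MDifferentiableAt 𝓘(ℝ, ℝ) I.tangent
      (fun s ↦ (TotalSpace.mk' E (c s) (Z s) : TangentBundle I M)) s₀)
    (hc : velocity I c s₀ = 0) (hD : covariantDerivAlong cov c Z s₀ = 0) :
    HasMFDerivAt 𝓘(ℝ, ℝ) I.tangent
      (fun s ↦ (TotalSpace.mk' E (c s) (Z s) : TangentBundle I M)) s₀ 0 := by
  set L : ℝ → TangentBundle I M := fun s ↦ TotalSpace.mk' E (c s) (Z s) with hL_def
  have hF0 : deriv (fun s ↦ ((trivializationAt E (TangentSpace I : M → Type _) (c s₀)) (L s)).2)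
      s₀ = 0 := by
    rw [← continuousLinearMapAt_covariantDerivAlong_of_velocity_eq_zero cov hZ hc, hD, map_zero]
  set e := trivializationAt E (TangentSpace I : M → Type _) (c s₀) with he_def
  have he : c s₀ ∈ e.baseSet := FiberBundle.mem_baseSet_trivializationAt' (c s₀)
  have hsrc : L s₀ ∈ e.source := e.mem_source.2 he
  have hcd : MDifferentiableAt 𝓘(ℝ, ℝ) I c s₀ := mdifferentiableAt_of_mdifferentiableAt_lift hZ
  have hev : ∀ᶠ s in 𝓝 s₀, c s ∈ e.baseSet :=
    hcd.continuousAt.preimage_mem_nhds (e.open_baseSet.mem_nhds he)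
  -- the fibre coordinate has zero derivative
  have hFd : DifferentiableAt ℝ (fun s ↦ (e (L s)).2) s₀ := differentiableAt_trivialization_lift e hZ he
  have hF : HasMFDerivAt 𝓘(ℝ, ℝ) 𝓘(ℝ, E) (fun s ↦ (e (L s)).2) s₀ 0 := by
    have h := hFd.hasDerivAt
    rw [hF0] at h
    have h' := h.hasFDerivAt
    have h0 : ContinuousLinearMap.toSpanSingleton ℝ (0 : E) = 0 := by
      ext; simp
    rw [h0] at h'
    exact hasMFDerivAt_iff_hasFDerivAt.2 h'
  -- the base curve has zero derivative
  have hc0 : mfderiv 𝓘(ℝ, ℝ) I c s₀ = 0 := by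
    have h1 : mfderiv 𝓘(ℝ, ℝ) I c s₀ (1 : ℝ) = 0 := hc
    exact ContinuousLinearMap.ext_ring h1
  have hcH : HasMFDerivAt 𝓘(ℝ, ℝ) I c s₀ 0 := hcd.hasMFDerivAt.congr_mfderiv hc0
  -- hence `e ∘ L = (c, fibre coordinate)` has zero derivative
  have hpair : HasMFDerivAt 𝓘(ℝ, ℝ) (I.prod 𝓘(ℝ, E)) (fun s ↦ (c s, (e (L s)).2)) s₀ 0 := by
    exact (hcH.prodMk hF).congr_mfderiv (ContinuousLinearMap.ext fun _ ↦ rfl)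
  have hpev : (fun s ↦ e (L s)) =ᶠ[𝓝 s₀] fun s ↦ (c s, (e (L s)).2) := by
    filter_upwards [hev] with s hs
    exact (e.mk_proj_snd' (x := L s) hs).symm
  have heL : HasMFDerivAt 𝓘(ℝ, ℝ) (I.prod 𝓘(ℝ, E)) (fun s ↦ e (L s)) s₀ 0 :=
    hpair.congr_of_eventuallyEq hpev
  -- pull back through the inverse chart
  have htgt : e (L s₀) ∈ e.target := e.map_source hsrc
  have hsymm : MDifferentiableAt (I.prod 𝓘(ℝ, E)) I.tangent e.toOpenPartialHomeomorph.symm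
      (e (L s₀)) :=
    ((e.contMDiffOn_symm (n := 1) (IB := I)).mdifferentiableOn one_ne_zero _ htgt).mdifferentiableAt
      (e.open_target.mem_nhds htgt)
  have hcomp := hsymm.hasMFDerivAt.comp s₀ heL
  rw [ContinuousLinearMap.comp_zero] at hcomp
  refine hcomp.congr_of_eventuallyEq ?_
  filter_upwards [hev] with s hs
  exact (e.symm_apply_apply (e.mem_source.2 hs)).symm

/-- **Conversely, a zero tangent vector in `T(TM)` has vanishing base velocity and vanishing
`D_s Z`**: if the lift `β(s) = (c s, Z s)` is differentiable at `s₀` with `β'(s₀) = 0`, then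
`c'(s₀) = 0` and `D_s Z(s₀) = 0` (read `β` in the chart `e` of `TM` at `c s₀`: both components of
`e ∘ β` have zero derivative; then `continuousLinearMapAt_covariantDerivAlong_of_velocity_eq_zero`
and injectivity of `e` on the fibre). O'Neill 1983, Ch. 3, Prop. 3.18; Lee 2018, Problem 4-7.
[cite: ONeill1983, Ch. 3, Prop. 3.18] -/
theorem covariantDerivAlong_eq_zero_of_mfderiv_lift_eq_zero {c : ℝ → M}
    {Z : Π s : ℝ, TangentSpace I (c s)} {s₀ : ℝ}
    (hZ : MDifferentiableAt 𝓘(ℝ, ℝ) I.tangent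
      (fun s ↦ (TotalSpace.mk' E (c s) (Z s) : TangentBundle I M)) s₀)
    (hL : mfderiv 𝓘(ℝ, ℝ) I.tangent
      (fun s ↦ (TotalSpace.mk' E (c s) (Z s) : TangentBundle I M)) s₀ = 0) :
    velocity I c s₀ = 0 ∧ covariantDerivAlong cov c Z s₀ = 0 := by
  set L : ℝ → TangentBundle I M := fun s ↦ TotalSpace.mk' E (c s) (Z s) with hL_def
  have key : velocity I c s₀ = 0 ∧
      deriv (fun s ↦ ((trivializationAt E (TangentSpace I : M → Type _) (c s₀)) (L s)).2) s₀ = 0 := by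
    set e := trivializationAt E (TangentSpace I : M → Type _) (c s₀) with he_def
    have he : c s₀ ∈ e.baseSet := FiberBundle.mem_baseSet_trivializationAt' (c s₀)
    have hsrc : L s₀ ∈ e.source := e.mem_source.2 he
    have hcd : MDifferentiableAt 𝓘(ℝ, ℝ) I c s₀ := mdifferentiableAt_of_mdifferentiableAt_lift hZ
    have hev : ∀ᶠ s in 𝓝 s₀, c s ∈ e.baseSet :=
      hcd.continuousAt.preimage_mem_nhds (e.open_baseSet.mem_nhds he)
    have heD : MDifferentiableAt I.tangent (I.prod 𝓘(ℝ, E)) e (L s₀) :=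
      ((e.contMDiffOn (n := 1) (IB := I)).mdifferentiableOn one_ne_zero _ hsrc).mdifferentiableAt
        (e.open_source.mem_nhds hsrc)
    have hcomp : HasMFDerivAt 𝓘(ℝ, ℝ) (I.prod 𝓘(ℝ, E)) (fun s ↦ e (L s)) s₀ 0 := by
      have h := heD.hasMFDerivAt.comp s₀ hZ.hasMFDerivAt
      rw [hL, ContinuousLinearMap.comp_zero] at h
      exact h
    -- first component
    have h1 : HasMFDerivAt 𝓘(ℝ, ℝ) I (fun s ↦ (e (L s)).1) s₀ 0 := by
      have h := (hasMFDerivAt_fst (I := I) (I' := 𝓘(ℝ, E)) (e (L s₀))).comp s₀ hcomp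
      rw [ContinuousLinearMap.comp_zero] at h
      exact h
    have h1ev : c =ᶠ[𝓝 s₀] fun s ↦ (e (L s)).1 := by
      filter_upwards [hev] with s hs
      exact (e.coe_fst' (x := L s) hs).symm
    have hc0 : HasMFDerivAt 𝓘(ℝ, ℝ) I c s₀ 0 := h1.congr_of_eventuallyEq h1ev
    have hvel : velocity I c s₀ = 0 := by
      show mfderiv 𝓘(ℝ, ℝ) I c s₀ 1 = 0
      rw [hc0.mfderiv]
      rfl
    -- second component
    have h2 : HasMFDerivAt 𝓘(ℝ, ℝ) 𝓘(ℝ, E) (fun s ↦ (e (L s)).2) s₀ 0 := by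
      have h := (hasMFDerivAt_snd (I := I) (I' := 𝓘(ℝ, E)) (e (L s₀))).comp s₀ hcomp
      rw [ContinuousLinearMap.comp_zero] at h
      exact h
    have hF0 : deriv (fun s ↦ (e (L s)).2) s₀ = 0 := by
      have h3 : HasFDerivAt (fun s ↦ (e (L s)).2) (0 : ℝ →L[ℝ] E) s₀ :=
        hasMFDerivAt_iff_hasFDerivAt.1 h2
      have h4 : HasDerivAt (fun s ↦ (e (L s)).2) 0 s₀ := by
        simpa using h3.hasDerivAt
      exact h4.deriv
    exact ⟨hvel, hF0⟩
  obtain ⟨hvel, hF0⟩ := key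
  refine ⟨hvel, ?_⟩
  have hA := continuousLinearMapAt_covariantDerivAlong_of_velocity_eq_zero cov hZ hvel
  rw [hF0] at hA
  have he : c s₀ ∈ (trivializationAt E (TangentSpace I : M → Type _) (c s₀)).baseSet :=
    FiberBundle.mem_baseSet_trivializationAt' (c s₀)
  have hinj : Function.Injective
      ((trivializationAt E (TangentSpace I : M → Type _) (c s₀)).continuousLinearMapAt ℝ (c s₀)) := by
    rw [← Trivialization.coe_continuousLinearEquivAt_eq _ he]
    exact ((trivializationAt E (TangentSpace I : M → Type _) (c s₀)).continuousLinearEquivAt ℝ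
      (c s₀) he).injective
  exact hinj (by rw [hA, map_zero])

/-! ### The variation fields of the exponential variation are nondegenerate -/

omit [IsManifold I ∞ M] [FiniteDimensional ℝ E] in
/-- Transport of a velocity along an equality of parameters (all tangent spaces are the model
space `E`). [folklore] -/
theorem velocity_congr_point {γ : ℝ → M} {a b : ℝ} (h : a = b) :
    (show E from velocity I γ a) = (show E from velocity I γ b) := by
  subst h
  rfl

variable {cov} [CompleteSpace E] [T2Space M] [BoundarylessManifold I M]
  [CovariantDerivative.ContMDiffCovariantDerivative cov 1]
  [CovariantDerivative.ContMDiffCovariantDerivative cov ∞]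

/-- **A Jacobi field of the exponential variation with `J(t₁) = 0` and `D_t J(t₁) = 0` is
trivial** (Lee 2018, Prop. 10.2: Jacobi fields are determined by their value and derivative at one
point; used in the proof of Thm. 10.26 to see that the broken field has a genuine corner). Let `cov`
be complete, torsion-free and `C^∞`, `Γ(t, s) = exp_x(t(v + s w))`, `J(t) = ∂_sΓ(t, 0)` the Jacobi
field along `γ_v` with `J(0) = 0`, `D_t J(0) = w` (`ExpMapJacobiField.lean`). If `J(t₁) = 0` and
`D_t J(t₁) = 0` for some `t₁ ≥ 0`, then `w = 0`. Proof through the geodesic flow: see the module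
docstring. [cite: LeeRiemannianManifolds2018, Prop. 10.2 and Thm. 10.26 (proof)] -/
theorem eq_zero_of_velocity_eq_zero_of_covariantDerivAlong_eq_zero (htors : cov.torsion = 0)
    (hc : IsGeodesicallyComplete cov) (x : M) (v w : TangentSpace I x) {t₁ : ℝ} (ht₁ : 0 ≤ t₁)
    (hJ : velocity I (fun s : ℝ ↦ expMap cov x (t₁ • (v + s • w))) 0 = 0)
    (hJ' : covariantDerivAlong cov (fun t ↦ expMap cov x (t • (v + (0 : ℝ) • w)))
      (fun t ↦ velocity I (fun s : ℝ ↦ expMap cov x (t • (v + s • w))) 0) t₁ = 0) :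
    w = 0 := by
  set Γ : ℝ → ℝ → M := fun t s ↦ expMap cov x (t • (v + s • w)) with hΓ_def
  have hΓs : ContMDiff (𝓘(ℝ, ℝ).prod 𝓘(ℝ, ℝ)) I ∞ (uncurry Γ) :=
    contMDiff_uncurry_expVariation hc x v w
  have h2 : (2 : ℕ∞ω) ≤ ∞ := WithTop.coe_le_coe.2 le_top
  -- the lift of `T = ∂_t Γ` is smooth in `(t, s)`
  have hT : ContMDiff (𝓘(ℝ, ℝ).prod 𝓘(ℝ, ℝ)) I.tangent ∞ (fun q : ℝ × ℝ ↦
      (TotalSpace.mk' E (Γ q.1 q.2) (velocity I (fun t ↦ Γ t q.2) q.1) : TangentBundle I M)) :=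
    contMDiff_lift_velocity_uncurry_left hΓs
  have hline : ContMDiff 𝓘(ℝ, ℝ) (𝓘(ℝ, ℝ).prod 𝓘(ℝ, ℝ)) ∞ (fun s : ℝ ↦ ((t₁, s) : ℝ × ℝ)) :=
    contMDiff_const.prodMk contMDiff_id
  -- the curve `β(s) = (Γ(t₁, s), -∂_tΓ(t₁, s))`
  set c : ℝ → M := fun s ↦ Γ t₁ s with hc_def
  set Z : Π s : ℝ, TangentSpace I (c s) := fun s ↦ -velocity I (fun t ↦ Γ t s) t₁ with hZ_def
  have hTl : ContMDiff 𝓘(ℝ, ℝ) I.tangent ∞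
      (fun s ↦ (TotalSpace.mk' E (c s) (velocity I (fun t ↦ Γ t s) t₁) : TangentBundle I M)) :=
    hT.comp hline
  have hZsm : ContMDiff 𝓘(ℝ, ℝ) I.tangent ∞
      (fun s ↦ (TotalSpace.mk' E (c s) (Z s) : TangentBundle I M)) :=
    fun s ↦ contMDiffAt_liftAlong_neg (hTl s)
  have hZd : MDifferentiableAt 𝓘(ℝ, ℝ) I.tangent
      (fun s ↦ (TotalSpace.mk' E (c s) (Z s) : TangentBundle I M)) 0 :=
    (hZsm 0).mdifferentiableAt (by simp)
  have hTd : MDifferentiableAt 𝓘(ℝ, ℝ) I.tangent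
      (fun s ↦ (TotalSpace.mk' E (c s) (velocity I (fun t ↦ Γ t s) t₁) : TangentBundle I M)) 0 :=
    (hTl 0).mdifferentiableAt (by simp)
  -- base velocity `J(t₁) = 0`
  have hc0 : velocity I c 0 = 0 := hJ
  -- `D_s Z(0) = -D_s ∂_tΓ(t₁, 0) = -D_t J(t₁) = 0`
  have hsymm : covariantDerivAlong cov (fun t' ↦ Γ t' 0) (fun t' ↦ velocity I (Γ t') 0) t₁ =
      covariantDerivAlong cov (Γ t₁) (fun s'' ↦ velocity I (fun t' ↦ Γ t' s'') t₁) 0 :=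
    covariantDerivAlong_velocity_comm cov htors ((hΓs (t₁, 0)).of_le h2)
  have hDT : covariantDerivAlong cov c (fun s ↦ velocity I (fun t ↦ Γ t s) t₁) 0 = 0 := by
    show covariantDerivAlong cov (Γ t₁) (fun s'' ↦ velocity I (fun t' ↦ Γ t' s'') t₁) 0 = 0
    rw [← hsymm]
    exact hJ'
  have hDZ : covariantDerivAlong cov c Z 0 = 0 := by
    have h := covariantDerivAlong_smul_holds (cov := cov) (γ := c)
      (W := fun s ↦ velocity I (fun t ↦ Γ t s) t₁) (f := fun _ : ℝ ↦ (-1 : ℝ)) (t₀ := 0)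
      (differentiableAt_const _) hTd
    rw [deriv_const, zero_smul, zero_add, hDT, smul_zero] at h
    have hfun : (fun s : ℝ ↦ (fun _ : ℝ ↦ (-1 : ℝ)) s • velocity I (fun t ↦ Γ t s) t₁) = Z := by
      funext s
      simp only [hZ_def, neg_smul, one_smul]
    rw [hfun] at h
    exact h
  have hβ : HasMFDerivAt 𝓘(ℝ, ℝ) I.tangent
      (fun s ↦ (TotalSpace.mk' E (c s) (Z s) : TangentBundle I M)) 0 0 :=
    hasMFDerivAt_lift_zero_of_covariantDerivAlong_eq_zero cov hZd hc0 hDZ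
  -- the time-`t₁` geodesic flow is differentiable at `β(0)`
  set Φ : TangentBundle I M → TangentBundle I M :=
    fun q ↦ tangentLift I (maximalGeodesic cov q.proj q.2) t₁ with hΦ_def
  have hdom : Icc 0 t₁ ⊆ maximalGeodesicDomain cov (TotalSpace.mk' E (c 0) (Z 0) : TangentBundle I M).proj
      (TotalSpace.mk' E (c 0) (Z 0) : TangentBundle I M).2 := by
    rw [(maximalGeodesic_of_isGeodesicallyComplete hc _ _).1]
    exact subset_univ _
  obtain ⟨𝒱, h𝒱o, hmem, -, hΦs⟩ := exists_nhds_contMDiffOn_geodesicFlow_of_subset (cov := cov)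
    (k := (⊤ : ℕ∞)) le_top (TotalSpace.mk' E (c 0) (Z 0) : TangentBundle I M) ht₁ hdom
  have hΦd : MDifferentiableAt I.tangent I.tangent Φ (TotalSpace.mk' E (c 0) (Z 0)) :=
    (hΦs.mdifferentiableOn (by simp) _ hmem).mdifferentiableAt (h𝒱o.mem_nhds hmem)
  have hcompΦ := hΦd.hasMFDerivAt.comp 0 hβ
  rw [ContinuousLinearMap.comp_zero] at hcompΦ
  -- `Φ(β(s)) = (x, -v + s(-w))`: the data at time `t₁` of the reversed geodesic `t ↦ Γ(t₁ - t, s)`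
  have hα : ∀ s : ℝ, Φ (TotalSpace.mk' E (c s) (Z s)) =
      TotalSpace.mk' E x ((-v) + s • (-w) : TangentSpace I x) := by
    intro s
    set ρ : ℝ → M := fun t ↦ Γ ((-1) * t + t₁) s with hρ_def
    have hgeo : IsGeodesic cov (fun t ↦ Γ t s) := isGeodesic_expVariation hc x v w s
    have hρgeo : IsGeodesicOn cov ρ univ := by
      have h := IsGeodesicOn.comp_affine_holds (cov := cov) hgeo (-1) t₁
      rwa [preimage_univ] at h
    have hρ0 : tangentLift I ρ 0 = TotalSpace.mk' E (c s) (Z s) := by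
      have hv : (show E from velocity I ρ 0) =
          (-1 : ℝ) • (show E from velocity I (fun t ↦ Γ t s) ((-1) * 0 + t₁)) :=
        velocity_comp_affine (I := I) (fun t ↦ Γ t s) (-1) t₁ 0
      have h00 : (-1 : ℝ) * 0 + t₁ = t₁ := by ring
      rw [velocity_congr_point (I := I) (γ := fun t ↦ Γ t s) h00, neg_one_smul] at hv
      refine TotalSpace.ext ?_ ?_
      · show Γ ((-1) * 0 + t₁) s = Γ t₁ s
        rw [h00]
      · exact heq_of_eq hv
    have hρt₁ : tangentLift I ρ t₁ = TotalSpace.mk' E x ((-v) + s • (-w) : TangentSpace I x) := by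
      have hv : (show E from velocity I ρ t₁) =
          (-1 : ℝ) • (show E from velocity I (fun t ↦ Γ t s) ((-1) * t₁ + t₁)) :=
        velocity_comp_affine (I := I) (fun t ↦ Γ t s) (-1) t₁ t₁
      have h0 : (-1 : ℝ) * t₁ + t₁ = 0 := by ring
      have hvel0 : (show E from velocity I (fun t ↦ Γ t s) 0) = (show E from v) + s • (show E from w) :=
        velocity_expMap_smul_zero x (v + s • w)
      rw [velocity_congr_point (I := I) (γ := fun t ↦ Γ t s) h0, hvel0] at hv
      have hΓ0 : Γ 0 s = x := by
        show expMap cov x ((0 : ℝ) • (v + s • w)) = x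
        rw [zero_smul]
        exact expMap_zero (cov := cov) x
      have hneg : (-1 : ℝ) • ((show E from v) + s • (show E from w)) =
          -(show E from v) + s • -(show E from w) := by
        rw [neg_one_smul, neg_add, smul_neg]
      rw [hneg] at hv
      refine TotalSpace.ext ?_ ?_
      · show Γ ((-1) * t₁ + t₁) s = x
        rw [h0]
        exact hΓ0
      · exact heq_of_eq hv
    have heqOn := tangentLift_eqOn_maximalGeodesic_of_isGeodesicOn (cov := cov) isOpen_univ
      ordConnected_univ (mem_univ 0) hρgeo rfl rfl (mem_univ t₁)
    have hΦρ : Φ (tangentLift I ρ 0) =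
        tangentLift I (maximalGeodesic cov (ρ 0) (velocity I ρ 0)) t₁ := rfl
    rw [← hρ0, hΦρ, ← heqOn, hρt₁]
  have hfun : (Φ ∘ fun s ↦ (TotalSpace.mk' E (c s) (Z s) : TangentBundle I M)) =
      fun s : ℝ ↦ (TotalSpace.mk' E x ((-v) + s • (-w) : TangentSpace I x) : TangentBundle I M) :=
    funext hα
  rw [hfun] at hcompΦ
  -- read off `D_s(-v + s(-w))|₀ = -w = 0` along the constant curve
  obtain ⟨-, hD⟩ := covariantDerivAlong_eq_zero_of_mfderiv_lift_eq_zero cov (c := fun _ ↦ x)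
    (Z := fun s : ℝ ↦ ((-v) + s • (-w) : TangentSpace I x)) hcompΦ.mdifferentiableAt hcompΦ.mfderiv
  rw [covariantDerivAlong_const_line cov x (-v) (-w) 0] at hD
  exact neg_eq_zero.1 hD

end Literature.Geometry.Riemannian

end
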